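import Summits.CriticalPhenomena.PercolationContinuityZ3.Theorems.PercNearOneGluingNoHeavyLowerTailSunflowerMultiPetalClutterTypeVector
import Summits.CriticalPhenomena.PercolationContinuityZ3.Theorems.PercNearOneGluingNoHeavyLowerTailSunflowerMultiPetalKempeIdentity
import Summits.CriticalPhenomena.PercolationContinuityZ3.Theorems.PercNearOneGluingNoHeavyLowerTailSunflowerMultiPetalKempeUnion
import HarnessLib
import HarnessLib.Audit

/-!
# `NoHeavyLowerTail` (crux stmt-CriticalPhenomena-4575), Lemma B for graph clutters: the BRIDGE between the bottom-spectator functional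
# `QKW univ (ofClutter E)` of the edge family of a graph and the colouring-language functional `Qcol G`

Support file (seat `prim-l12-p2` gen 40; `--supports stmt-CriticalPhenomena-4575`; companion of `…SunflowerMultiPetalClutterTypeVector`
(p386339: `memCount`, `capOf`, `qK_lab_eq_lbW`, `pparts`, `typeOf`), `…SunflowerMultiPetalKempeNormalForm` (`Qcol`, `cnt`, `qcol`),
`…SunflowerMultiPetalKempeIdentity` (`kempe_identity`, `Qcol_nonneg_of_linked`) and `…SunflowerMultiPetalKempeUnion` (`cap3`, `ctype`, `lbW_ctype`,
`Qcol_nonneg_of_MZQConnected`)).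
No `sorry`; nothing is asserted about the crux.

For a family `E : Fin k → Finset V` of nonempty sets that counts, inside every vertex set `X`, exactly the edges of `G` inside `X`
(`IsEdgeFamily`; the canonical enumeration `edgeFam G` of the edge set is one, `isEdgeFamily_edgeFam`), the bottom-spectator functional of
the injectively coloured clutter `ofClutter E` on the whole cube is the colouring sum `Qcol G` (`QKW_ofClutter_eq_Qcol`): ordered 3-partitions
`(X, Y, Z)` of `V` are colourings `σ : V → Fin 3`, the capped member counts are the capped colour counts `X_c(σ) ∧ 2`, and `lbW` of the capped
type is the weight `qcol` (`lbW_ctype` of `…KempeUnion`).  Consequently (`QKW_edgeFam_nonneg_of_linked`) the graph case of `ClutterBottomSlackK` follows from the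
linked inequality of `…SunflowerMultiPetalKempeIdentity`.
-/

namespace Summit.CriticalPhenomena.PercolationContinuityZ3.Theorems.SunflowerPartition.Kempe

open Finset
open scoped Classical

variable {V : Type*} [Fintype V] (G : SimpleGraph V)

/-! ## Edge families -/

/-- `E` is an EDGE FAMILY of `G`: inside every vertex set it has exactly as many members as `G` has edges. [this work] -/
def IsEdgeFamily {k : ℕ} (E : Fin k → Finset V) : Prop :=
  ∀ X : Finset V, memCount E X = ((edges G).filter fun e => ∀ v ∈ e, v ∈ X).card

/-- The edges inside the colour class `c` are the monochromatic edges of colour `c`. [this work] -/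
theorem filter_edges_subset_class (σ : V → Fin 3) (c : Fin 3) :
    ((edges G).filter fun e => ∀ v ∈ e, v ∈ (univ : Finset V).filter fun v => σ v = c) = monoCol G σ c := by
  ext e
  induction e using Sym2.ind with
  | _ u w =>
    rw [mem_filter, mem_edges, mk_mem_edgeSet_iff, mk_mem_monoCol_iff]
    simp only [Sym2.mem_iff, mem_filter, mem_univ, true_and, forall_eq_or_imp, forall_eq]

/-- For an edge family the member count of a colour class is the colour count. [this work] -/
theorem memCount_class {k : ℕ} {E : Fin k → Finset V} (hE : IsEdgeFamily G E) (σ : V → Fin 3) (c : Fin 3) :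
    memCount E ((univ : Finset V).filter fun v => σ v = c) = cnt G σ c := by
  rw [hE, filter_edges_subset_class]; rfl

/-! ## Colourings as ordered 3-partitions -/

/-- The first two colour classes of a colouring. [this work] -/
noncomputable def classes (σ : V → Fin 3) : Finset V × Finset V :=
  ((univ : Finset V).filter fun v => σ v = 0, (univ : Finset V).filter fun v => σ v = 1)

/-- The colouring with prescribed first two classes. [this work] -/
noncomputable def ofClasses (q : Finset V × Finset V) : V → Fin 3 :=
  fun v => if v ∈ q.1 then 0 else if v ∈ q.2 then 1 else 2

/-- The third class is the complement of the first two. [this work] -/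
theorem third_class (σ : V → Fin 3) :
    (univ : Finset V) \ ((classes σ).1 ∪ (classes σ).2) = (univ : Finset V).filter fun v => σ v = 2 := by
  ext v
  simp only [classes, mem_sdiff, mem_univ, mem_union, mem_filter, true_and, not_or]
  constructor
  · rintro ⟨h0, h1⟩; rcases fin3_cases (σ v) with h | h | h
    · exact (h0 h).elim
    · exact (h1 h).elim
    · exact h
  · intro h; rw [h]; decide

/-- `classes σ` is an ordered pair of disjoint sets. [this work] -/
theorem classes_mem_pparts (σ : V → Fin 3) : classes σ ∈ pparts (univ : Finset V) := by
  rw [mem_pparts]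
  refine ⟨⟨subset_univ _, subset_univ _⟩, ?_⟩
  rw [Finset.disjoint_left]
  intro v h0 h1
  simp only [classes, mem_filter, mem_univ, true_and] at h0 h1
  rw [h0] at h1; exact absurd h1 (by decide)

/-- Round trip: colouring → classes → colouring. [this work] -/
theorem ofClasses_classes (σ : V → Fin 3) : ofClasses (classes σ) = σ := by
  funext v
  simp only [ofClasses, classes, mem_filter, mem_univ, true_and]
  rcases fin3_cases (σ v) with h | h | h <;> simp [h]

/-- Round trip: disjoint pair → colouring → classes. [this work] -/
theorem classes_ofClasses {q : Finset V × Finset V} (hq : q ∈ pparts (univ : Finset V)) : classes (ofClasses q) = q := by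
  obtain ⟨-, hd⟩ := mem_pparts.1 hq
  have hd' : ∀ v, v ∈ q.1 → v ∉ q.2 := fun v hv => Finset.disjoint_left.1 hd hv
  ext v <;> simp only [classes, ofClasses, mem_filter, mem_univ, true_and]
  · by_cases h1 : v ∈ q.1
    · simp [h1]
    · by_cases h2 : v ∈ q.2 <;> simp [h1, h2]
  · by_cases h1 : v ∈ q.1
    · simp [h1, hd' v h1]
    · by_cases h2 : v ∈ q.2 <;> simp [h1, h2]

/-! ## The bridge -/

/-- **BRIDGE**: for an edge family `E` of nonempty sets, the bottom-spectator functional of the coloured clutter `ofClutter E` on the whole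
cube is the colouring-language Lemma-B functional: `QKW univ = Qcol G`. [this work] -/
theorem QKW_ofClutter_eq_Qcol {k : ℕ} (E : Fin k → Finset V) (hne : ∀ i, (E i).Nonempty) (hE : IsEdgeFamily G E) :
    (MSunflower.ofClutter E).QKW univ = Qcol G := by
  -- the nested sum as a sum of `lbW (typeOf)` over disjoint pairs
  have h1 : (MSunflower.ofClutter E).QKW univ = ∑ q ∈ pparts (univ : Finset V), lbW (typeOf E univ q) := by
    unfold MSunflower.QKW
    rw [nested_eq_sum_filter]
    refine sum_congr rfl fun q hq => ?_
    have hd : Disjoint q.1 q.2 := (mem_filter.1 hq).2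
    have h13 : Disjoint q.1 (univ \ (q.1 ∪ q.2)) := Finset.disjoint_sdiff.mono_left subset_union_left
    have h23 : Disjoint q.2 (univ \ (q.1 ∪ q.2)) := Finset.disjoint_sdiff.mono_left subset_union_right
    exact qK_lab_eq_lbW E hne hd h13 h23
  rw [h1]
  unfold Qcol
  symm
  refine sum_nbij' classes ofClasses (fun σ _ => classes_mem_pparts σ) (fun q _ => mem_univ _)
    (fun σ _ => ofClasses_classes σ) (fun q hq => classes_ofClasses hq) (fun σ _ => ?_)
  -- the summand: `qcol σ = lbW (typeOf (classes σ))`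
  rw [typeOf, third_class]
  have hc : ∀ c : Fin 3, capOf E ((univ : Finset V).filter fun v => σ v = c) = cap3 (cnt G σ c) := fun c => by
    apply Fin.ext
    show min (memCount E ((univ : Finset V).filter fun v => σ v = c)) 2 = min (cnt G σ c) 2
    rw [memCount_class G hE]
  change qcol G σ = lbW (capOf E ((univ : Finset V).filter fun v => σ v = 0), capOf E ((univ : Finset V).filter fun v => σ v = 1),
    capOf E ((univ : Finset V).filter fun v => σ v = 2))
  rw [hc, hc, hc, ← lbW_ctype]; rfl

/-! ## The canonical edge family -/

/-- The vertex set of an unordered pair. [this work] -/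
noncomputable def verts (e : Sym2 V) : Finset V := (univ : Finset V).filter fun v => v ∈ e

/-- The canonical enumeration of the edges of `G` as two-element vertex sets. [this work] -/
noncomputable def edgeFam : Fin (edges G).card → Finset V := fun i => verts (((edges G).equivFin.symm i : edges G) : Sym2 V)

/-- `verts e ⊆ X` iff both ends lie in `X`. [this work] -/
theorem verts_subset_iff (e : Sym2 V) (X : Finset V) : verts e ⊆ X ↔ ∀ v ∈ e, v ∈ X := by
  unfold verts
  constructor
  · intro h v hv; exact h (mem_filter.2 ⟨mem_univ _, hv⟩)
  · intro h v hv; exact h v (mem_filter.1 hv).2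

/-- The members of the canonical family are nonempty. [this work] -/
theorem edgeFam_nonempty (i : Fin (edges G).card) : (edgeFam G i).Nonempty := by
  unfold edgeFam
  set e : Sym2 V := (((edges G).equivFin.symm i : edges G) : Sym2 V) with he
  induction e using Sym2.ind with
  | _ u w => exact ⟨u, mem_filter.2 ⟨mem_univ _, Sym2.mem_mk_left _ _⟩⟩

/-- The canonical family is an edge family. [this work] -/
theorem isEdgeFamily_edgeFam : IsEdgeFamily G (edgeFam G) := by
  intro X
  unfold memCount edgeFam
  refine card_bij (fun i _ => (((edges G).equivFin.symm i : edges G) : Sym2 V)) (fun i hi => ?_) (fun i₁ _ i₂ _ h => ?_)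
    (fun e he => ?_)
  · rw [mem_filter] at hi ⊢
    exact ⟨((edges G).equivFin.symm i).2, (verts_subset_iff _ X).1 hi.2⟩
  · exact (edges G).equivFin.symm.injective (Subtype.ext h)
  · rw [mem_filter] at he
    refine ⟨(edges G).equivFin ⟨e, he.1⟩, ?_, ?_⟩
    · rw [mem_filter, Equiv.symm_apply_apply]
      exact ⟨mem_univ _, (verts_subset_iff _ X).2 he.2⟩
    · rw [Equiv.symm_apply_apply]

/-- **The graph case of Lemma B in the tree's language is `0 ≤ Qcol G`**: `QKW univ (ofClutter (edgeFam G)) = Qcol G`. [this work] -/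
theorem QKW_edgeFam_eq_Qcol : (MSunflower.ofClutter (edgeFam G)).QKW univ = Qcol G :=
  QKW_ofClutter_eq_Qcol G (edgeFam G) (edgeFam_nonempty G) (isEdgeFamily_edgeFam G)

/-- **Lemma B for the graph, in the tree's language, from the linked inequality**: if `3·Σ₂Λ + Σ₃ΣΛ ≤ 6|A*| + 3·Σ₂L₌ + Σ₃ΣL₌`
(memo §4; census-clean for all graphs on ≤ 9 vertices) then `0 ≤ QKW univ (ofClutter (edgeFam G))`. [this work] -/
theorem QKW_edgeFam_nonneg_of_linked
    (h : 3 * ∑ M ∈ match2 G, (LK G M M : ℤ) + ∑ M ∈ match3 G, ∑ p ∈ M.powersetCard 2, (LK G M p : ℤ) ≤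
      6 * ((Astar G).card : ℤ) + 3 * ∑ M ∈ match2 G, (LE G M M : ℤ) + ∑ M ∈ match3 G, ∑ p ∈ M.powersetCard 2, (LE G M p : ℤ)) :
    0 ≤ (MSunflower.ofClutter (edgeFam G)).QKW univ := by
  rw [QKW_edgeFam_eq_Qcol]; exact Qcol_nonneg_of_linked G h

/-- **The graph case of `ClutterBottomSlackK` from the connected one-point obligation**: `MZQConnected → 0 ≤ QKW univ (ofClutter (edgeFam G))`. [this work] -/
theorem QKW_edgeFam_nonneg_of_MZQConnected (h : MZQConnected) {W : Type} [Fintype W] (H : SimpleGraph W) :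
    0 ≤ (MSunflower.ofClutter (edgeFam H)).QKW univ := by
  rw [QKW_edgeFam_eq_Qcol]; exact Qcol_nonneg_of_MZQConnected' h H

end Summit.CriticalPhenomena.PercolationContinuityZ3.Theorems.SunflowerPartition.Kempe
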